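import Mathlib

/-!
# Clause 13-J/13-R, edge brick E1 (EXTERIOR INDUCTION OF A CLAMPED FIELD IS CONTROLLED BY ITS NEAR-EDGE SLOPE)

Route `FilamentSkeletonRss`, ∃-side clause 13 (`Clause13RNearStraightL`, stmt-NavierStokesRegularity-23612; typing-agnostic).  Design of record:
lane memo `filament-plan/DESIGN-23612-currency-b-edge-lane-g19.md` §9–§10 (currency point (b) of the TENURE note
`DESIGN-23612-currency-b-tenure-g30.md`): for a test variation `Y` that vanishes identically beyond an exit point `e` of the tangency ball, the
model defect at an exterior point `e + d` is the pure nonlocal induction `−iG·∫ K_q(e+d−σ)·Y(σ) dσ`; the clause's hypothesis controls it AT `d = 0`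
(the exit point belongs to the closed ball), and for `d > 0` it is controlled by the SLOPE of `Y` on the last stretch `[e−T, e]` before the edge plus
a tail — the elementary Taylor step of the recommended clamped architecture (the slope itself is the business of the clamped low-piece estimate).
This file proves the kernel-agnostic real-analysis fact:

* `norm_integral_kernel_clamped_le` — if `Y ∈ C¹(ℝ, ℂ)` vanishes on `[e, ∞)`, `‖Y′‖ ≤ S` on `[e−T, e]` and `‖Y‖ ≤ M` everywhere, then for every
  `d` and every continuous integrable kernel `K` with `v ↦ v·K(d+v)` integrable on `(0, T]`:
  `‖∫ K(e+d−σ)·Y(σ) dσ‖ ≤ S·∫_{(0,T]} |K(d+v)|·v dv + M·∫_{(T,∞)} |K(d+v)| dv`;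
* `norm_sub_le_mul_of_deriv_clamped` — the mean-value step `‖Y(e−v)‖ ≤ S·v` for `v ∈ [0, T]`;
* `norm_integral_kernel_clamped_le_left` — the mirror statement at a left edge;
* `modelOperator_at_exit_eq` — at an exit point (`Y(e) = Y′(e) = 0`) the model defect `iG((2/q)Y − K_q∗Y) − wY′ + β₁Y + β₂Ȳ` equals `−iG·(K_q∗Y)(e)`,
  i.e. the clause's in-ball hypothesis at the exit point bounds the exterior induction there.
Lane ns-filament-19175-p1 g19; `--supports stmt-NavierStokesRegularity-23612 --as helper`.
HONEST FRAMING: an elementary inequality used in the bookkeeping of a HYPOTHETICAL filament skeleton on the NEGATIVE side of a MODEL route; nothing here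
bears on Navier–Stokes regularity or blow-up.
-/

noncomputable section

open MeasureTheory Real Set Complex

namespace Summit.NavierStokesRegularity.NavierStokesRegularity.Theorems.MatchedKernel
set_option linter.dupNamespace false

/-- **Mean-value step at a clamped edge.**  If `Y ∈ C¹` vanishes at `e` and `‖Y′‖ ≤ S` on `[e − T, e]`, then `‖Y (e − v)‖ ≤ S·v` for
`v ∈ [0, T]`. [folklore] -/
theorem norm_sub_le_mul_of_deriv_clamped {Y : ℝ → ℂ} (hY : ContDiff ℝ 1 Y) {e T S : ℝ} (hYe : Y e = 0)
    (hS : ∀ σ ∈ Icc (e - T) e, ‖deriv Y σ‖ ≤ S) {v : ℝ} (hv0 : 0 ≤ v) (hvT : v ≤ T) :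
    ‖Y (e - v)‖ ≤ S * v := by
  have hdiff : Differentiable ℝ Y := hY.differentiable one_ne_zero
  -- mean value inequality on the segment `[e - v, e]`
  have hseg : ∀ x ∈ Icc (e - v) e, ‖deriv Y x‖ ≤ S := fun x hx =>
    hS x ⟨by linarith [hx.1], hx.2⟩
  have hmvt := Convex.norm_image_sub_le_of_norm_deriv_le (f := Y) (s := Icc (e - v) e)
    (fun x _ => hdiff.differentiableAt) hseg (convex_Icc _ _) (right_mem_Icc.2 (by linarith)) (left_mem_Icc.2 (by linarith))
  -- `‖Y (e - v) - Y e‖ ≤ S * ‖(e - v) - e‖`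
  rw [hYe, sub_zero] at hmvt
  have hev : (e - v) - e = -v := by ring
  have habs : ‖(e - v) - e‖ = v := by
    rw [hev, norm_neg, Real.norm_eq_abs, abs_of_nonneg hv0]
  rw [habs] at hmvt
  exact hmvt

/-- **EXTERIOR INDUCTION OF A CLAMPED FIELD.**  Let `Y ∈ C¹(ℝ, ℂ)` vanish on `[e, ∞)`, with `‖Y′‖ ≤ S` on `[e − T, e]` (`T > 0`) and `‖Y‖ ≤ M`
everywhere; let `K : ℝ → ℝ` be continuous and integrable, with `v ↦ v·K(d+v)` integrable on `(0, T]`.  Then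
`‖∫ K(e + d − σ)·Y(σ) dσ‖ ≤ S·∫_{v ∈ (0,T]} |K(d+v)|·v + M·∫_{v ∈ (T,∞)} |K(d+v)|`.  (Substitute `σ = e − v`: the integrand vanishes for `v < 0`,
is `≤ |K(d+v)|·S·v` on `(0,T]` by the mean-value step, and `≤ |K(d+v)|·M` beyond.) [folklore] -/
theorem norm_integral_kernel_clamped_le {Y : ℝ → ℂ} (hY : ContDiff ℝ 1 Y) {e T S M : ℝ} (hT : 0 < T)
    (hYe : ∀ σ, e ≤ σ → Y σ = 0) (hS : ∀ σ ∈ Icc (e - T) e, ‖deriv Y σ‖ ≤ S) (hM : ∀ σ, ‖Y σ‖ ≤ M)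
    {K : ℝ → ℝ} (hKc : Continuous K) (hKi : Integrable K) (d : ℝ)
    (hKv : IntegrableOn (fun v : ℝ => |K (d + v)| * v) (Ioc 0 T)) :
    ‖∫ σ : ℝ, ((K (e + d - σ) : ℝ) : ℂ) * Y σ‖
      ≤ S * (∫ v in Ioc 0 T, |K (d + v)| * v) + M * ∫ v in Ioi T, |K (d + v)| := by
  have hS0 : 0 ≤ S := le_trans (norm_nonneg _) (hS e (right_mem_Icc.2 (by linarith)))
  have hM0 : 0 ≤ M := le_trans (norm_nonneg _) (hM e)
  have hYc : Continuous Y := hY.continuous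
  -- substitute `σ = e − v`
  have hsub : ∫ σ : ℝ, ((K (e + d - σ) : ℝ) : ℂ) * Y σ = ∫ v : ℝ, ((K (d + v) : ℝ) : ℂ) * Y (e - v) := by
    have h := (MeasureTheory.integral_sub_left_eq_self (fun σ : ℝ => ((K (e + d - σ) : ℝ) : ℂ) * Y σ) (μ := volume) e).symm
    -- `∫ f σ = ∫ f (e - v)`
    rw [h]
    refine integral_congr_ae (ae_of_all _ fun v => ?_)
    simp only
    congr 2
    ring
  rw [hsub]
  -- pointwise bound by the nonnegative function `g`
  set g : ℝ → ℝ := fun v => (Ioc 0 T).indicator (fun v => |K (d + v)| * (S * v)) v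
      + (Ioi T).indicator (fun v => |K (d + v)| * M) v with hg
  have hKdc : Continuous fun v : ℝ => K (d + v) := hKc.comp (continuous_const.add continuous_id)
  have hKdi : Integrable fun v : ℝ => K (d + v) := hKi.comp_add_left d
  have hg1 : Integrable ((Ioc 0 T).indicator fun v : ℝ => |K (d + v)| * (S * v)) := by
    refine (IntegrableOn.integrable_indicator ?_ measurableSet_Ioc)
    have : (fun v : ℝ => |K (d + v)| * (S * v)) = fun v => S * (|K (d + v)| * v) := by
      funext v; ring
    rw [this]
    exact hKv.const_mul S
  have hg2 : Integrable ((Ioi T).indicator fun v : ℝ => |K (d + v)| * M) := by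
    refine (IntegrableOn.integrable_indicator ?_ measurableSet_Ioi)
    exact ((hKdi.norm.mul_const M).integrableOn)
  have hgi : Integrable g := hg1.add hg2
  have hbound : ∀ v : ℝ, ‖((K (d + v) : ℝ) : ℂ) * Y (e - v)‖ ≤ g v := by
    intro v
    rw [norm_mul, Complex.norm_real, Real.norm_eq_abs]
    by_cases hv0 : v ≤ 0
    · -- `e - v ≥ e`: the field vanishes
      have : Y (e - v) = 0 := hYe _ (by linarith)
      rw [this, norm_zero, mul_zero]
      simp only [hg]
      refine add_nonneg (Set.indicator_nonneg (fun x hx => ?_) _) (Set.indicator_nonneg (fun x _ => ?_) _)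
      · exact mul_nonneg (abs_nonneg _) (mul_nonneg hS0 hx.1.le)
      · exact mul_nonneg (abs_nonneg _) hM0
    · have hv0 : 0 < v := lt_of_not_ge hv0
      by_cases hvT : v ≤ T
      · have h1 : ‖Y (e - v)‖ ≤ S * v := norm_sub_le_mul_of_deriv_clamped hY (hYe e le_rfl) hS hv0.le hvT
        have hmem : v ∈ Ioc 0 T := ⟨hv0, hvT⟩
        have hnot : v ∉ Ioi T := fun h => absurd hvT (not_le.2 h)
        simp only [hg, Set.indicator_of_mem hmem, Set.indicator_of_notMem hnot, add_zero]
        exact mul_le_mul_of_nonneg_left h1 (abs_nonneg _)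
      · have hvT : T < v := lt_of_not_ge hvT
        have hmem : v ∈ Ioi T := hvT
        have hnot : v ∉ Ioc 0 T := fun h => absurd h.2 (not_le.2 hvT)
        simp only [hg, Set.indicator_of_mem hmem, Set.indicator_of_notMem hnot, zero_add]
        exact mul_le_mul_of_nonneg_left (hM _) (abs_nonneg _)
  -- integrate
  have hint := norm_integral_le_of_norm_le hgi (ae_of_all _ hbound)
  refine hint.trans (le_of_eq ?_)
  simp only [hg]
  rw [integral_add hg1 hg2, MeasureTheory.integral_indicator measurableSet_Ioc, MeasureTheory.integral_indicator measurableSet_Ioi]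
  have e1 : ∫ v in Ioc 0 T, |K (d + v)| * (S * v) = S * ∫ v in Ioc 0 T, |K (d + v)| * v := by
    rw [← MeasureTheory.integral_const_mul]
    refine setIntegral_congr_fun measurableSet_Ioc fun v _ => ?_
    ring
  have e2 : ∫ v in Ioi T, |K (d + v)| * M = M * ∫ v in Ioi T, |K (d + v)| := by
    rw [← MeasureTheory.integral_const_mul]
    refine setIntegral_congr_fun measurableSet_Ioi fun v _ => ?_
    ring
  rw [e1, e2]

/-- **Left-edge version** (mirror image): if `Y ∈ C¹(ℝ, ℂ)` vanishes on `(−∞, e]`, `‖Y′‖ ≤ S` on `[e, e + T]` and `‖Y‖ ≤ M`, then for the exterior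
point `e − d`: `‖∫ K(e − d − σ)·Y(σ) dσ‖ ≤ S·∫_{(0,T]} |K(−(d+v))|·v + M·∫_{(T,∞)} |K(−(d+v))|`. [folklore] -/
theorem norm_integral_kernel_clamped_le_left {Y : ℝ → ℂ} (hY : ContDiff ℝ 1 Y) {e T S M : ℝ} (hT : 0 < T)
    (hYe : ∀ σ, σ ≤ e → Y σ = 0) (hS : ∀ σ ∈ Icc e (e + T), ‖deriv Y σ‖ ≤ S) (hM : ∀ σ, ‖Y σ‖ ≤ M)
    {K : ℝ → ℝ} (hKc : Continuous K) (hKi : Integrable K) (d : ℝ)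
    (hKv : IntegrableOn (fun v : ℝ => |K (-(d + v))| * v) (Ioc 0 T)) :
    ‖∫ σ : ℝ, ((K (e - d - σ) : ℝ) : ℂ) * Y σ‖
      ≤ S * (∫ v in Ioc 0 T, |K (-(d + v))| * v) + M * ∫ v in Ioi T, |K (-(d + v))| := by
  -- reflect: `Ỹ x = Y (2e − x)`, `K̃ u = K (−u)`
  set Yr : ℝ → ℂ := fun x => Y (2 * e - x) with hYr
  set Kr : ℝ → ℝ := fun u => K (-u) with hKr
  have hlin : ContDiff ℝ 1 (fun x : ℝ => 2 * e - x) := (contDiff_const.sub contDiff_id)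
  have hYrC : ContDiff ℝ 1 Yr := hY.comp hlin
  have hYre : ∀ σ, e ≤ σ → Yr σ = 0 := fun σ hσ => hYe _ (by linarith)
  have hderiv : ∀ σ, deriv Yr σ = -deriv Y (2 * e - σ) := by
    intro σ
    have h1 : HasDerivAt (fun x : ℝ => 2 * e - x) (-1) σ := by
      simpa using ((hasDerivAt_id σ).const_sub (2 * e))
    have h2 : HasDerivAt Y (deriv Y (2 * e - σ)) (2 * e - σ) :=
      (hY.differentiable one_ne_zero _).hasDerivAt
    have h : HasDerivAt Yr ((-1 : ℝ) • deriv Y (2 * e - σ)) σ := h2.scomp σ h1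
    rw [h.deriv, neg_one_smul]
  have hYrS : ∀ σ ∈ Icc (e - T) e, ‖deriv Yr σ‖ ≤ S := by
    intro σ hσ
    rw [hderiv, norm_neg]
    exact hS _ ⟨by linarith [hσ.2], by linarith [hσ.1]⟩
  have hYrM : ∀ σ, ‖Yr σ‖ ≤ M := fun σ => hM _
  have hKrc : Continuous Kr := hKc.comp continuous_neg
  have hKri : Integrable Kr := hKi.comp_neg
  have hKrv : IntegrableOn (fun v : ℝ => |Kr (d + v)| * v) (Ioc 0 T) := by
    simpa only [hKr] using hKv
  have h := norm_integral_kernel_clamped_le hYrC hT hYre hYrS hYrM hKrc hKri d hKrv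
  -- identify the two integrals by the reflection `σ ↦ 2e − σ`
  have hrefl : ∫ σ : ℝ, ((Kr (e + d - σ) : ℝ) : ℂ) * Yr σ = ∫ σ : ℝ, ((K (e - d - σ) : ℝ) : ℂ) * Y σ := by
    have h1 := (MeasureTheory.integral_sub_left_eq_self (fun σ : ℝ => ((K (e - d - σ) : ℝ) : ℂ) * Y σ) (μ := volume) (2 * e)).symm
    rw [h1]
    refine integral_congr_ae (ae_of_all _ fun σ => ?_)
    simp only [hKr, hYr]
    congr 2
    ring
  rw [hrefl] at h
  simpa only [hKr] using h

/-- **At an exit point the model defect IS the exterior induction.**  If `Y(e) = 0` and `Y′(e) = 0` (a `C¹` test variation vanishing beyond the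
exit point `e`), then the 1-D model defect at `e` reduces to `−iG·(K_q∗Y)(e)`: no local term survives. [folklore] -/
theorem modelOperator_at_exit_eq {q G : ℝ} {Y : ℝ → ℂ} {w : ℝ → ℝ} {β₁ β₂ : ℝ → ℂ} {e : ℝ}
    (hYe : Y e = 0) (hY'e : deriv Y e = 0) :
    I * (G : ℂ) * ((2 / q : ℂ) * Y e
        - ∫ σ : ℝ, ((((2 * q - (e - σ) ^ 2) * (((e - σ) ^ 2 + q) ^ (5 / 2 : ℝ))⁻¹ : ℝ)) : ℂ) * Y σ)
      - ((w e : ℝ) : ℂ) * deriv Y e + β₁ e * Y e + β₂ e * (starRingEnd ℂ) (Y e)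
      = -(I * (G : ℂ)) * ∫ σ : ℝ, ((((2 * q - (e - σ) ^ 2) * (((e - σ) ^ 2 + q) ^ (5 / 2 : ℝ))⁻¹ : ℝ)) : ℂ) * Y σ := by
  rw [hYe, hY'e]
  simp only [mul_zero, map_zero, add_zero, sub_zero]
  ring

end Summit.NavierStokesRegularity.NavierStokesRegularity.Theorems.MatchedKernel

end
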